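import Mathlib
import Literature.Analysis.FluidPDE.TypeIAncientMild
import Summits.NavierStokesRegularity.NavierStokesRegularity.Theses.SymmetryModuliCount
import Summits.NavierStokesRegularity.NavierStokesRegularity.Theorems.SymmetryModuliCountRigidComotionVanishesOnEnd
import Summits.NavierStokesRegularity.NavierStokesRegularity.Theorems.SymmetryModuliCountHelicalEndLiouvilleForwardVanishing
import HarnessLib

/-!
# Route SymmetryModuliCount — the time-anchor collapse as an importable theorem:
# `X ↔ ForcedSymmetry` given the two Killing leaves

Line `time-anchor-bootstrap` of crux `ForcedSymmetry` (stmt-NavierStokesRegularity-4052), lead prover.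
The route file (rev 6) INLINES in its deciding theorem `closes` the "time-anchor collapse": the class
`A_C` is backward-shift invariant while the crux anchors scalings at `t = 0`, so `ForcedSymmetry`
applied to `u` AND to `u(·−1)` leaves on the backward end `t < −1` either a Killing symmetry
`x ↦ a + Ax` (helical/periodic leaf `HelicalEndLiouville`, stmt-14062, or axisymmetric leaf
`AxisymEndLiouville`, stmt-14061) or a rigid co-motion (lethal by the PROVED item
`RigidComotionVanishesOnEnd`, stmt-14063, `symmetryModuliCount_rigidComotionVanishesOnEnd_proof`), and
vanishing on the end propagates forward (PROVED item `BackwardEndVanishing`, stmt-14064,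
`symmetryModuliCount_backwardEndVanishing_proof`). This file makes that step importable and records the
resulting DEGENERACY of the crux exactly:

* `typeIAncientLiouville_of_forcedSymmetry_of_killingLeaves :
    HelicalEndLiouville → AxisymEndLiouville → ForcedSymmetry → TypeIAncientLiouville`;
* `forcedSymmetry_of_typeIAncientLiouville : TypeIAncientLiouville → ForcedSymmetry` (the zero field is
  symmetric; Disproof §4);
* `typeIAncientLiouville_iff_forcedSymmetry_of_killingLeaves :
    HelicalEndLiouville → AxisymEndLiouville → (TypeIAncientLiouville ↔ ForcedSymmetry)`.

So, modulo the two Killing-leaf items (both declared closable in the route text), the crux IS the target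
`X` — the weakest-hypothesis form of the panel finding "ForcedSymmetry ≡ X" (TRIAGE-r1-1/2/3,
`Cruxes/ForcedSymmetry/Disproof.lean` §4). Sorry-free; conditional only on the route decls taken as
hypotheses. The Step-0/Step-1 argument is transplanted verbatim from the planner's `closes`
(route file rev 6, 2026-08-16), with the two proved items supplied as tree theorems.
-/

noncomputable section

-- `Summit.NavierStokesRegularity.NavierStokesRegularity` repeats a component by design (summit = sub-problem).
set_option linter.dupNamespace false

namespace Summit.NavierStokesRegularity.NavierStokesRegularity.Theorems

open Literature.Analysis.FluidPDE Set Function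
open Summit.NavierStokesRegularity.NavierStokesRegularity.Theses.SymmetryModuliCount
  (ForcedSymmetry TypeIAncientLiouville HelicalEndLiouville AxisymEndLiouville)

/-- **The Killing leaf on a backward end** = helical/periodic leaf + axisymmetric leaf, split on whether
the translation part lies in the range of the rotation part (Step 0 of the route's `closes`).
CONDITIONAL on the two route items. [folklore] -/
theorem collapse_killingLeaf (hH : HelicalEndLiouville) (hA : AxisymEndLiouville) :
    ∀ (C : ℝ) (u : ℝ → EuclideanSpace ℝ (Fin 3) → EuclideanSpace ℝ (Fin 3)),
      Literature.Analysis.FluidPDE.IsTypeIAncientMild C u →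
      ∀ (a : EuclideanSpace ℝ (Fin 3)) (A : EuclideanSpace ℝ (Fin 3) →L[ℝ] EuclideanSpace ℝ (Fin 3)) (θ : ℝ),
        (∀ x, inner ℝ (A x) x = 0) → ¬ (a = 0 ∧ A = 0) → θ ≤ 0 →
        (∀ t < θ, ∀ x, fderiv ℝ (u t) x (a + A x) - A (u t x) = 0) → ∀ t < θ, ∀ x, u t x = 0 := by
  intro C u hu a A θ hAs hne hθ hsym
  by_cases hr : a ∈ Set.range A
  · obtain ⟨c', hc'⟩ := hr
    have hA0 : A ≠ 0 := by
      rintro rfl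
      exact hne ⟨by simpa using hc'.symm, rfl⟩
    refine hA C u hu (-c') A θ hAs hA0 hθ ?_
    intro t ht x
    have key := hsym t ht x
    have e : A (x - -c') = a + A x := by
      rw [map_sub, map_neg, hc']; abel
    rw [e]
    exact key
  · exact hH C u hu a A θ hAs hr hθ hsym

/-- **The time-anchor collapse, importable**: the two Killing-leaf items and the crux `ForcedSymmetry`
give the target `X = TypeIAncientLiouville`. Apply `ForcedSymmetry` to `u` and to the backward shift
`u(·−1)` (`IsTypeIAncientMild.comp_sub_right`); on `t < −1` the two anchored generators are either
Killing (`collapse_killingLeaf`) or combine (`σ₁ξ₀ − σ₀ξ₁`) to a rigid co-motion with `τ = −2σ₀σ₁ ≠ 0`,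
lethal by the PROVED item `RigidComotionVanishesOnEnd`; vanishing on the end propagates by the PROVED
item `BackwardEndVanishing`. Transplanted from the route's `closes` (rev 6) Step 1. CONDITIONAL on
`HelicalEndLiouville`, `AxisymEndLiouville`. [folklore] -/
theorem typeIAncientLiouville_of_forcedSymmetry_of_killingLeaves (hH : HelicalEndLiouville)
    (hA : AxisymEndLiouville) (hF : ForcedSymmetry) : TypeIAncientLiouville := by
  have hR := symmetryModuliCount_rigidComotionVanishesOnEnd_proof
  have hB := symmetryModuliCount_backwardEndVanishing_proof
  unfold Summit.NavierStokesRegularity.NavierStokesRegularity.Theses.SymmetryModuliCount.RigidComotionVanishesOnEnd at hR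
  unfold Summit.NavierStokesRegularity.NavierStokesRegularity.Theses.SymmetryModuliCount.BackwardEndVanishing at hB
  have hKill := collapse_killingLeaf hH hA
  intro C u hu
  have hu' : Literature.Analysis.FluidPDE.IsTypeIAncientMild C u :=
    Literature.Analysis.FluidPDE.isTypeIAncientMild_iff.2 hu
  have hshift : Literature.Analysis.FluidPDE.IsTypeIAncientMild C (fun t => u (t - 1)) :=
    hu'.comp_sub_right zero_le_one
  obtain ⟨a₀, σ₀, A₀, hA₀, hne₀, h₀⟩ := hF C u hu
  obtain ⟨a₁, σ₁, A₁, hA₁, hne₁, h₁⟩ :=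
    hF C (fun t => u (t - 1)) (Literature.Analysis.FluidPDE.isTypeIAncientMild_iff.1 hshift)
  -- transport the generator of the shifted field to a generator of `u` anchored at `t = -1`
  have h₁' : ∀ t < (-1 : ℝ), ∀ x, fderiv ℝ (u t) x (a₁ + σ₁ • x + A₁ x) + σ₁ • u t x
      + (2 * σ₁ * t + 2 * σ₁) • Literature.Analysis.FluidPDE.timeDeriv u t x - A₁ (u t x) = 0 := by
    intro t ht x
    have key := h₁ (t + 1) (by linarith) x
    have hd : Literature.Analysis.FluidPDE.timeDeriv (fun s => u (s - 1)) (t + 1) x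
        = Literature.Analysis.FluidPDE.timeDeriv u t x := by
      simp only [Literature.Analysis.FluidPDE.timeDeriv_apply]
      rw [deriv_comp_sub_const (f := fun s => u s x) (a := (1 : ℝ)) (x := t + 1)]
      simp
    simp only [hd, add_sub_cancel_right] at key
    have hc : (2 * σ₁ * (t + 1)) = 2 * σ₁ * t + 2 * σ₁ := by ring
    rw [hc] at key
    exact key
  apply hB C u hu' (-1) (by norm_num)
  by_cases hσ₀ : σ₀ = 0
  · subst hσ₀
    have hne : ¬ (a₀ = 0 ∧ A₀ = 0) := fun h => hne₀ ⟨h.1, rfl, h.2⟩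
    refine hKill C u hu' a₀ A₀ (-1) hA₀ hne (by norm_num) ?_
    intro t ht x
    have := h₀ t (by linarith) x
    simpa using this
  by_cases hσ₁ : σ₁ = 0
  · subst hσ₁
    have hne : ¬ (a₁ = 0 ∧ A₁ = 0) := fun h => hne₁ ⟨h.1, rfl, h.2⟩
    refine hKill C u hu' a₁ A₁ (-1) hA₁ hne (by norm_num) ?_
    intro t ht x
    have := h₁' t ht x
    simpa using this
  -- both scaling rates nonzero: subtract the two anchored generators → rigid co-motion, τ = -2σ₀σ₁ ≠ 0
  refine hR C u hu' (σ₁ • a₀ - σ₀ • a₁) (σ₁ • A₀ - σ₀ • A₁) (-(2 * σ₀ * σ₁)) (-1) ?_ ?_ (by norm_num) ?_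
  · intro x
    simp [inner_sub_left, inner_smul_left, hA₀ x, hA₁ x]
  · have : σ₀ * σ₁ ≠ 0 := mul_ne_zero hσ₀ hσ₁
    intro h
    apply this
    linarith
  · intro t ht x
    have k₀ := h₀ t (by linarith) x
    have k₁ := h₁' t ht x
    simp only [map_add, map_smul, _root_.sub_apply, _root_.smul_apply, map_sub] at k₀ k₁ ⊢
    linear_combination (norm := module) σ₁ • k₀ - σ₀ • k₁

/-- **`X ⇒ ForcedSymmetry`**: the zero field has every similarity symmetry (translation by `e₀`), so
`A_C = {0}` makes the crux vacuous (`Cruxes/ForcedSymmetry/Disproof.lean` §4). [folklore] -/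
theorem forcedSymmetry_of_typeIAncientLiouville (hX : TypeIAncientLiouville) : ForcedSymmetry := by
  intro C u hu
  have h0 : ∀ t < 0, ∀ x, u t x = 0 := hX C u hu
  refine ⟨EuclideanSpace.single 0 1, 0, 0, fun x => by simp, ?_, ?_⟩
  · rintro ⟨h1, -, -⟩
    have := congrArg (fun v : EuclideanSpace ℝ (Fin 3) => v 0) h1
    simp at this
  · intro t ht x
    have hut : u t = fun _ => 0 := funext (h0 t ht)
    simp [hut]

/-- **Degeneracy of the crux, exactly**: given the two Killing-leaf items `HelicalEndLiouville`
(stmt-14062) and `AxisymEndLiouville` (stmt-14061) — both declared closable in the route text — the crux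
`ForcedSymmetry` (stmt-4052) is EQUIVALENT to the target `X = TypeIAncientLiouville` (stmt-4050).
CONDITIONAL on the two items. [folklore] -/
theorem typeIAncientLiouville_iff_forcedSymmetry_of_killingLeaves (hH : HelicalEndLiouville)
    (hA : AxisymEndLiouville) : TypeIAncientLiouville ↔ ForcedSymmetry :=
  ⟨forcedSymmetry_of_typeIAncientLiouville,
    typeIAncientLiouville_of_forcedSymmetry_of_killingLeaves hH hA⟩

end Summit.NavierStokesRegularity.NavierStokesRegularity.Theorems

end
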